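import Mathlib

/-!
# EriceRemainderEnclosureHistoryAutonomyComparisonAgeCompositionDeficitProduct — (E102a) route (N), first order: THE TWO-LETTER PAIR CAP IN CLOSED
# FORM (pure).  The old-pair polytope of (E99a) has two letters, K: `A·x + κ·y ≤ 1` and J: `κ·x + B·y ≤ 1` (`κ` = the own-window coefficient
# `2c`, `A` = the younger age's coefficient in the older window, `B` = the older age's coefficient in the younger window).  (E99b) `old_pair_box`
# certified `x + y ≤ V` only where ONE letter alone does it (`A ≥ 1∕V` or `B ≥ 1∕V`) — the pure dichotomy, good to span `≈ 2.4`.  Between the two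
# regimes the optimum of the 2 × 2 linear programme is the VERTEX, and LP duality is explicit: multiplying K by `κ − B ≥ 0` and J by `κ − A ≥ 0`
# gives `(x + y)(κ² − AB) ≤ 2κ − A − B`, and `2κ − A − B ≤ V(κ² − AB)` is IDENTICALLY `V·[(κ − 1∕V)² − (1∕V − A)(1∕V − B)] ≥ 0`.  So
#     **`x + y ≤ V` as soon as the DEFICIT PRODUCT `(1∕V − A)⁺(1∕V − B)⁺ ≤ (κ − 1∕V)²`**                         (**`pair_cap_of_deficit_product`**)
# — one inequality, no multipliers to tabulate, monotone in `A` and `B` separately, so a box `[F₁,F₂] × [σ₁,σ₂]` of span and level ratio is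
# certified by evaluating `A` at `σ₂` and `B` at `σ₁` (**`old_pair_box_two`**, with the SPLIT K letter of the sequel (E102b): the stretch
# `(m+j, m+k]` read by the ray for its first `T = ⌊θj⌋` levels and by the floor `h_{m+k}` after).  Numerics (`HOME/b2b-balaban-beta-d4-p2/g89/numerics/
# cert_pair.py`, exact `Fraction`): 13–27 boxes per span bracket certify `0.635 ∕ 0.645 ∕ 0.665 ∕ 0.675 ∕ 0.70 ∕ 0.715 ∕ 0.74 ∕ 0.755` on
# `(2,3] ∕ (3,4] ∕ (4,6] ∕ (6,8] ∕ (8,12] ∕ (12,16] ∕ (16,24] ∕ (24,32]` (LP values of the letters `0.621 ∕ 0.630 ∕ 0.645 ∕ 0.659 ∕ 0.680 ∕ 0.696 ∕ 0.720 ∕ 0.737`;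
# the argmax certificate of (E100e)∕(E101c) gives `0.6875 ∕ 0.77 ∕ 0.89 ∕ 1.05` at spans `4 ∕ 8 ∕ 16 ∕ 32`).

Cell `pub-balaban`, β-function sub-cell, BINDER row D4 «RemainderConst leaves for Bałaban's split» (`HOME/BINDER-OWNERS.md`; owner lineage `b2b-balaban-beta-an4`;
this file by co-owner #2 lineage `b2b-balaban-beta-d4-p2`, generation 89), β-FLOW TEAM duty (1), FREEZE (0) honoured (def-free; Mathlib only; nothing restated).

HONEST FRAMING (page 1, verbatim and binding).  *"Discharging BetaPertH makes Bałaban's UV stability UNCONDITIONAL — a real constructive-QFT result; it is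
NOT the continuum limit and NOT the Clay problem."*  THIS FILE DISCHARGES NOTHING OF THE KIND.  Elementary real algebra about real numbers satisfying two
linear inequalities — hypotheses of a census, not facts; the form, signs, ages and moments of Bałaban's (1.22) limit functional are NOT PRINTED ([I] p. 298;
GAPS G-t4-U2-1∕-2) and NOT asserted.  Row D4 class UNCHANGED (critical-path width 0; instance 0∕1; D4 DISCHARGE NO DATE).  HONEST DEPENDENCY: continuum YM
on T⁴ ⇐ BetaPertH ∧ nine spine estimates (0/9 proved); BetaPertH ⇐ (D1) ∧ (D4) ∧ CAP+tail; G-an2-4 gates asym, D1 and NE2/3/4.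

THE POINT (README `HOME/b2b-balaban-beta-d4-p2/g89/README.md` §2).  NOT CLAIMED: anything about flows (sequels); blocks of three or more ages (the
numerics of README §3 say the interior ages are never loaded — the three-window LP value equals the pair value of the outer two at every span —, but its
certificate is not typed); anything printed — NOT B12 Thm 2, NOT BetaPertH, NOT continuum, NOT Clay.

WHAT IS PROVED ([folklore]; 0 `def`, 0 sorry).  §1 **`pair_cap_of_deficit_product`**.  §2 **`old_pair_box_two`**.
-/
noncomputable section

namespace Summit.QuantumFields.BalabanUV.Beta.EriceRemainderEnclosureHistoryAutonomyComparisonAgeCompositionDeficitProduct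

/-! ## §1 The 2 × 2 linear programme in closed form -/

/-- **THE TWO-LETTER CAP BY THE DEFICIT PRODUCT (pure).**  Reals `x, y ≥ 0` with the letters `A·x + κ·y ≤ 1` and `κ·x + B·y ≤ 1`, lower bounds
`Alo ≤ A`, `0 ≤ Blo ≤ B` capped at `1∕V` (`Alo, Blo ≤ 1∕V < κ`), and the deficit product `(1∕V − Alo)(1∕V − Blo) ≤ (κ − 1∕V)²`.  THEN
`x + y ≤ V`: `(κ − Blo)·K + (κ − Alo)·J` reads `(x + y)(κ² − Alo·Blo) ≤ 2κ − Alo − Blo`, and `V(κ² − Alo·Blo) − (2κ − Alo − Blo) =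
V[(κ − 1∕V)² − (1∕V − Alo)(1∕V − Blo)] ≥ 0` — the optimal dual multipliers of the vertex, written out. [folklore] -/
theorem pair_cap_of_deficit_product {x y A B Alo Blo κ V : ℝ} (hx : 0 ≤ x) (hy : 0 ≤ y) (hV : 0 < V)
    (hK : A * x + κ * y ≤ 1) (hJ : κ * x + B * y ≤ 1) (hA : Alo ≤ A) (hB : Blo ≤ B) (hB0 : 0 ≤ Blo)
    (hAV : Alo ≤ 1 / V) (hBV : Blo ≤ 1 / V) (hκ : 1 / V < κ)
    (hprod : (1 / V - Alo) * (1 / V - Blo) ≤ (κ - 1 / V) ^ 2) : x + y ≤ V := by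
  have hK' : Alo * x + κ * y ≤ 1 := le_trans (by nlinarith [mul_le_mul_of_nonneg_right hA hx]) hK
  have hJ' : κ * x + Blo * y ≤ 1 := le_trans (by nlinarith [mul_le_mul_of_nonneg_right hB hy]) hJ
  have h1 : 0 ≤ κ - Blo := by linarith
  have h2 : 0 ≤ κ - Alo := by linarith
  have key : (x + y) * (κ ^ 2 - Alo * Blo) ≤ 2 * κ - Alo - Blo := by
    have e := add_le_add (mul_le_mul_of_nonneg_left hK' h1) (mul_le_mul_of_nonneg_left hJ' h2)
    have eq : (κ - Blo) * (Alo * x + κ * y) + (κ - Alo) * (κ * x + Blo * y) = (x + y) * (κ ^ 2 - Alo * Blo) := by ring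
    linarith [e, eq]
  have hiV : 0 < 1 / V := by positivity
  have hpos : 0 < κ ^ 2 - Alo * Blo := by
    have hab : Alo * Blo ≤ 1 / V * (1 / V) := mul_le_mul hAV hBV hB0 hiV.le
    nlinarith [mul_lt_mul'' hκ hκ hiV.le hiV.le]
  have hcl : 2 * κ - Alo - Blo ≤ V * (κ ^ 2 - Alo * Blo) := by
    have eq : V * (κ ^ 2 - Alo * Blo) - (2 * κ - Alo - Blo) = V * ((κ - 1 / V) ^ 2 - (1 / V - Alo) * (1 / V - Blo)) := by
      field_simp
      ring
    have hnn : 0 ≤ V * ((κ - 1 / V) ^ 2 - (1 / V - Alo) * (1 / V - Blo)) := mul_nonneg hV.le (by linarith)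
    linarith [eq, hnn]
  exact le_of_mul_le_mul_right (key.trans hcl |>.trans_eq (by ring)) hpos

/-! ## §2 One box of span and level ratio, with the split K letter -/

/-- **ONE BOX OF THE WIDE OLD-PAIR CAP (pure).**  Loads `x, y ≥ 0` of ages `jr < kr` (reals, `j₀ ≤ jr`, `F₁·jr ≤ kr ≤ F₂·jr`), level ratio
`σ ∈ [σ₁, σ₂]` (`σ₁ > 0`), a split length `τ` with `θlo·jr ≤ τ ≤ θhi·jr` (`θlo ≥ 0`, `θhi + 1 ≤ F₁`), the SPLIT K LETTER
`(2c_T(τ∕jr)∕σ² + 2((kr − jr − τ)∕jr + c_b)∕σ³)·x + κ·y ≤ 1` and the J LETTER `κ·x + 2c_bσ²(jr∕kr)·y ≤ 1` (`c_T, c_b ≥ 0`); rational data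
`Alo ≤ min(1∕V, 2c_Tθlo∕σ₂² + 2(F₁ − 1 − θhi + c_b)∕σ₂³)`, `0 ≤ Blo ≤ min(1∕V, 2c_bσ₁²∕F₂)`, `1∕V < κ`, and the deficit product
`(1∕V − Alo)(1∕V − Blo) ≤ (κ − 1∕V)²`.  THEN `x + y ≤ V` (§1 after the monotone corner evaluation: the K coefficient is smallest at `σ₂`, the J
coefficient at `σ₁` and `kr = F₂jr`). [folklore] -/
theorem old_pair_box_two {x y σ jr kr τ cT cb κ θlo θhi F₁ F₂ σ₁ σ₂ V Alo Blo j₀ : ℝ} (hx : 0 ≤ x) (hy : 0 ≤ y)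
    (hj₀ : 0 < j₀) (hjr : j₀ ≤ jr) (hk1 : F₁ * jr ≤ kr) (hk2 : kr ≤ F₂ * jr) (hσ1 : σ₁ ≤ σ) (hσ2 : σ ≤ σ₂) (hσ₁ : 0 < σ₁)
    (hτlo : θlo * jr ≤ τ) (hτhi : τ ≤ θhi * jr) (hcT : 0 ≤ cT) (hcb : 0 ≤ cb) (hθlo : 0 ≤ θlo) (hθhi : θhi + 1 ≤ F₁)
    (hK : (2 * cT * (τ / jr) / σ ^ 2 + 2 * ((kr - jr - τ) / jr + cb) / σ ^ 3) * x + κ * y ≤ 1)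
    (hJ : κ * x + 2 * cb * σ ^ 2 * (jr / kr) * y ≤ 1) (hV : 0 < V) (hκ : 1 / V < κ)
    (hAlo : Alo ≤ 2 * cT * θlo / σ₂ ^ 2 + 2 * (F₁ - 1 - θhi + cb) / σ₂ ^ 3) (hAV : Alo ≤ 1 / V)
    (hBlo : Blo ≤ 2 * cb * σ₁ ^ 2 / F₂) (hB0 : 0 ≤ Blo) (hBV : Blo ≤ 1 / V)
    (hprod : (1 / V - Alo) * (1 / V - Blo) ≤ (κ - 1 / V) ^ 2) : x + y ≤ V := by
  have hjpos : 0 < jr := lt_of_lt_of_le hj₀ hjr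
  have hσ : 0 < σ := lt_of_lt_of_le hσ₁ hσ1
  have hσ₂ : 0 < σ₂ := lt_of_lt_of_le hσ hσ2
  have hθhi0 : 0 ≤ θhi := by
    have : 0 ≤ θhi * jr := le_trans (le_trans (mul_nonneg hθlo hjpos.le) hτlo) hτhi
    nlinarith
  have hF1 : 1 ≤ F₁ := by linarith
  have hkpos : 0 < kr := lt_of_lt_of_le (by nlinarith) hk1
  have hF2 : 0 < F₂ := by nlinarith
  -- the K coefficient at the worst corner
  have ht1 : θlo ≤ τ / jr := by rw [le_div_iff₀ hjpos]; exact hτlo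
  have ht2 : F₁ - 1 - θhi ≤ (kr - jr - τ) / jr := by
    rw [le_div_iff₀ hjpos]; nlinarith
  have hnum1 : 0 ≤ 2 * cT * θlo := by positivity
  have hnum2 : 0 ≤ 2 * (F₁ - 1 - θhi + cb) := by linarith
  have hA : Alo ≤ 2 * cT * (τ / jr) / σ ^ 2 + 2 * ((kr - jr - τ) / jr + cb) / σ ^ 3 := by
    have s2 : 1 / σ₂ ^ 2 ≤ 1 / σ ^ 2 := one_div_le_one_div_of_le (pow_pos hσ 2) (pow_le_pow_left₀ hσ.le hσ2 2)
    have s3 : 1 / σ₂ ^ 3 ≤ 1 / σ ^ 3 := one_div_le_one_div_of_le (pow_pos hσ 3) (pow_le_pow_left₀ hσ.le hσ2 3)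
    have a1 : 2 * cT * θlo / σ₂ ^ 2 ≤ 2 * cT * (τ / jr) / σ ^ 2 := by
      calc 2 * cT * θlo / σ₂ ^ 2 = 2 * cT * θlo * (1 / σ₂ ^ 2) := by ring
        _ ≤ 2 * cT * (τ / jr) * (1 / σ ^ 2) :=
            mul_le_mul (mul_le_mul_of_nonneg_left ht1 (by positivity)) s2 (by positivity)
              (by have : 0 ≤ τ := le_trans (mul_nonneg hθlo hjpos.le) hτlo; positivity)
        _ = 2 * cT * (τ / jr) / σ ^ 2 := by ring
    have a2 : 2 * (F₁ - 1 - θhi + cb) / σ₂ ^ 3 ≤ 2 * ((kr - jr - τ) / jr + cb) / σ ^ 3 := by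
      calc 2 * (F₁ - 1 - θhi + cb) / σ₂ ^ 3 = 2 * (F₁ - 1 - θhi + cb) * (1 / σ₂ ^ 3) := by ring
        _ ≤ 2 * ((kr - jr - τ) / jr + cb) * (1 / σ ^ 3) :=
            mul_le_mul (by linarith) s3 (by positivity) (by linarith)
        _ = 2 * ((kr - jr - τ) / jr + cb) / σ ^ 3 := by ring
    linarith
  -- the J coefficient at the worst corner
  have hB : Blo ≤ 2 * cb * σ ^ 2 * (jr / kr) := by
    have b1 : σ₁ ^ 2 ≤ σ ^ 2 := pow_le_pow_left₀ hσ₁.le hσ1 2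
    have b2 : 1 / F₂ ≤ jr / kr := by rw [div_le_div_iff₀ hF2 hkpos]; linarith
    calc Blo ≤ 2 * cb * σ₁ ^ 2 / F₂ := hBlo
      _ = 2 * cb * σ₁ ^ 2 * (1 / F₂) := by ring
      _ ≤ 2 * cb * σ ^ 2 * (jr / kr) := mul_le_mul (mul_le_mul_of_nonneg_left b1 (by positivity)) b2 (by positivity) (by positivity)
  exact pair_cap_of_deficit_product hx hy hV hK hJ hA hB hB0 hAV hBV hκ hprod

end Summit.QuantumFields.BalabanUV.Beta.EriceRemainderEnclosureHistoryAutonomyComparisonAgeCompositionDeficitProduct
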